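import Summits.Ventures.LatticeQCDFlow.Exactness.IMHCouplingTotalVariationDiagnosticSharp
import HarnessLib

/-!
# A start-adaptive convergence bound for the exact sampler, read off the coupling: from EVERY deterministic start `x`,
# `|π(S) − δ_x K^b(S)| ≤ ∫ a(x, y)·(1 − A(x ∨ y))^b / A(x ∨ y) q(dy)` (`x ∨ y` the heavier of the two), exact at the mode

HONEST FRAMING: exact (Metropolis-corrected) sampling algorithms for lattice gauge theory;
figures of merit are autocorrelation/cost numbers at stated couplings and volumes; no
continuum-physics claim.

Venture `LatticeQCDFlow` (cell pub-lqcd), topic `Exactness`; FANOUT row 30 (lean-1, GEN-39).  NEW WORK of the cell; sequel to this generation's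
`…TotalVariationDiagnostic` (`|π(S) − P(Y_b ∈ S)| ≤ Σ_{n≥0} P(X_{b+n} ≠ X′_{b+n})` under the lag-one coupling), `…MeetingTimeAnyCoupling`
(`P(X_n ≠ X′_n) = E[(1 − A(heavier start))ⁿ; X_0 ≠ X′_0]` from every initial coupling; standard Borel `Ω`, atom-free proposal) and
`…TotalVariationDiagnosticSharp` (the cold coupling `K(x, ·) ⊗ δ_x` satisfies the lag-one condition and carries the run started at `x`).
Composition: the residual series has the closed form `E[(1 − A(h))^b/A(h); X_0 ≠ X′_0]`, and for the run started AT ANY CONFIGURATION `x`, coupled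
one update apart, the starting pair is `(y, x)` with `y ∼ K(x, ·)`, so the bound becomes an explicit one-dimensional integral against the proposal
(`a(x, y) = min(1, w(y)/w(x))`, `A` the acceptance probability, `x ∨ y` = `y` if `w(x) ≤ w(y)` else `x`):

* §1 **`tsum_iterate_bind_crnPair_offDiagonal_shift_eq_anyCoupling`** — `Σ_{n≥0} P(X_{b+n} ≠ X′_{b+n}) = ∫_{O∩Δᶜ} (1 − A(p.1))^b A(p.1)⁻¹ dμ̂₀ +
  ∫_{Oᶜ∩Δᶜ} (1 − A(p.2))^b A(p.2)⁻¹ dμ̂₀` in `ℝ≥0∞`, every finite initial measure (`O = {w p.2 ≤ w p.1}`).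
* §2 **`crnLag_measureReal_sub_abs_le_lintegral_anyCoupling`** — every lag-one initial coupling `ν̂`: for every measurable `S`,
  `|π(S) − P(Y_b ∈ S)| ≤ E_{ν̂}[(1 − A(h))^b/A(h); X_0 ≠ X′_0]` (`h` the heavier start).
* §3 **`setLIntegral_compl_singleton_indepMH`** — `∫_{y≠x} g dK(x,·) = ∫ a(x,y) g(y) q(dy)` (no atom at `x`); **`lintegral_detLag_split`** — for `ν̂_x = K(x, ·) ⊗ δ_x` (no atom at `x`): `E_{ν̂_x}[g(h); X_0 ≠ X′_0] = ∫ a(x, y) g(x ∨ y) q(dy)`;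
  **`imh_detStart_measureReal_sub_abs_le`** — THE BOUND, kernel-free in its statement: for every `x`, every measurable `S`, every `b`,
  `|π(S) − δ_x K^b(S)| ≤ ∫ a(x, y)·(1 − A(x ∨ y))^b·A(x ∨ y)⁻¹ q(dy)`.  At the mode `x = x₀` the integrand is `w(y)·r^b` and the bound is `r^b`,
  the exact total variation (`…DiagnosticSharp`); informal reading, not a theorem here: from a light start the integrand decays at the acceptance
  rates of the configurations the run can actually jump to.
Reading (gauge files): the remaining systematic error of the exact gauge sampler started from a given configuration `U` after `b` updates is at
most a single proposal-average of `min(1, w(V)/w(U))·(1 − A(U ∨ V))^b / A(U ∨ V)` — computable from the model alone, and what coupled runs from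
`U` would report on average.
NOT CLAIMED: random (warm) starts beyond §2's abstract form; lower bounds away from the mode; comparison theorems with `r^b`; proposals with atoms
(finite `G`); any value of `A`.  No `sorry`, no new definitions, nothing cited as a fact.
-/

noncomputable section

namespace Summit.Ventures.LatticeQCDFlow.Exactness

open MeasureTheory ProbabilityTheory Function Finset Filter
open scoped _root_.ENNReal unitInterval Topology
open Summit.Ventures.LatticeQCDFlow.Scoring

variable {Ω : Type*} [MeasurableSpace Ω] {q : Measure Ω} [IsProbabilityMeasure q] {w : Ω → ℝ}

/-! ## §1 The residual series from every initial coupling, in closed form -/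

/-- **`Σ_{n≥0} (μ̂₀K̂^{b+n})(Δᶜ) = ∫_{O∩Δᶜ} (1 − A(p.1))^b A(p.1)⁻¹ dμ̂₀ + ∫_{Oᶜ∩Δᶜ} (1 − A(p.2))^b A(p.2)⁻¹ dμ̂₀`** in `ℝ≥0∞` (standard Borel `Ω`,
atom-free proposal, every finite initial measure on pairs). [ours] -/
theorem tsum_iterate_bind_crnPair_offDiagonal_shift_eq_anyCoupling [StandardBorelSpace Ω] [Nonempty Ω] [MeasurableSingletonClass Ω]
    [MeasurableEq Ω] (hw : Measurable w) (hw0 : ∀ y, 0 < w y) (hq : ∀ x, q {x} = 0) (Khat : Kernel (Ω × Ω) (Ω × Ω)) [IsMarkovKernel Khat]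
    (hK : ∀ z : Ω × Ω, Khat z = (q.prod (volume : Measure unitInterval)).map (fun p : Ω × unitInterval =>
      ((if (p.2 : ℝ) * w z.1 ≤ w p.1 then p.1 else z.1), (if (p.2 : ℝ) * w z.2 ≤ w p.1 then p.1 else z.2))))
    (μ₀ : Measure (Ω × Ω)) [IsFiniteMeasure μ₀] (b : ℕ) :
    ∑' n, ((fun m : Measure (Ω × Ω) => m.bind Khat)^[b + n] μ₀) (Set.diagonal Ω)ᶜ =
      ∫⁻ p in {p : Ω × Ω | w p.2 ≤ w p.1} ∩ (Set.diagonal Ω)ᶜ, (1 - imhAcceptMass q w p.1) ^ b * (imhAcceptMass q w p.1)⁻¹ ∂μ₀ +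
        ∫⁻ p in {p : Ω × Ω | w p.2 ≤ w p.1}ᶜ ∩ (Set.diagonal Ω)ᶜ, (1 - imhAcceptMass q w p.2) ^ b * (imhAcceptMass q w p.2)⁻¹ ∂μ₀ := by
  have hAm : Measurable fun x : Ω => imhAcceptMass q w x := measurable_imhAcceptMass q hw
  have h1 : ∀ n : ℕ, AEMeasurable (fun p : Ω × Ω => (1 - imhAcceptMass q w p.1) ^ (b + n))
      (μ₀.restrict ({p : Ω × Ω | w p.2 ≤ w p.1} ∩ (Set.diagonal Ω)ᶜ)) := fun n =>
    ((measurable_const.sub (hAm.comp measurable_fst)).pow_const _).aemeasurable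
  have h2 : ∀ n : ℕ, AEMeasurable (fun p : Ω × Ω => (1 - imhAcceptMass q w p.2) ^ (b + n))
      (μ₀.restrict ({p : Ω × Ω | w p.2 ≤ w p.1}ᶜ ∩ (Set.diagonal Ω)ᶜ)) := fun n =>
    ((measurable_const.sub (hAm.comp measurable_snd)).pow_const _).aemeasurable
  simp_rw [iterate_bind_crnPair_offDiagonal_eq_anyCoupling hw hw0 hq Khat hK _ μ₀]
  rw [ENNReal.tsum_add, ← lintegral_tsum h1, ← lintegral_tsum h2]
  congr 1
  · refine lintegral_congr fun p => ?_
    simp_rw [pow_add]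
    rw [ENNReal.tsum_mul_left, ENNReal.tsum_geometric, ENNReal.sub_sub_cancel ENNReal.one_ne_top (imhAcceptMass_le_one (q := q) (w := w) p.1)]
  · refine lintegral_congr fun p => ?_
    simp_rw [pow_add]
    rw [ENNReal.tsum_mul_left, ENNReal.tsum_geometric, ENNReal.sub_sub_cancel ENNReal.one_ne_top (imhAcceptMass_le_one (q := q) (w := w) p.2)]

/-! ## §2 The total-variation diagnostic from every lag-one coupling, in closed form -/

/-- **`|π(S) − P(Y_b ∈ S)| ≤ E_{ν̂}[(1 − A(h))^b/A(h); X_0 ≠ X′_0]`** for every lag-one initial coupling `ν̂` (`h` = the heavier starting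
configuration): `w` a `Fact`-measurable normalised weight, positive, maximal at `x₀`; standard Borel `Ω`, atom-free proposal. [ours] -/
theorem crnLag_measureReal_sub_abs_le_lintegral_anyCoupling [StandardBorelSpace Ω] [Nonempty Ω] [MeasurableSingletonClass Ω]
    [MeasurableEq Ω] [Fact (Measurable w)] (hw0 : ∀ y, 0 < w y) {x₀ : Ω} (hmax : ∀ y, w y ≤ w x₀)
    [IsProbabilityMeasure (q.withDensity fun y => ENNReal.ofReal (w y))] (hq : ∀ x, q {x} = 0)
    (Khat : Kernel (Ω × Ω) (Ω × Ω)) [IsMarkovKernel Khat]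
    (hK : ∀ z : Ω × Ω, Khat z = (q.prod (volume : Measure unitInterval)).map (fun p : Ω × unitInterval =>
      ((if (p.2 : ℝ) * w z.1 ≤ w p.1 then p.1 else z.1), (if (p.2 : ℝ) * w z.2 ≤ w p.1 then p.1 else z.2))))
    (ν : Measure (Ω × Ω)) [IsProbabilityMeasure ν] (hlag : ν.map Prod.fst = (ν.map Prod.snd).bind (indepMH q w))
    {S : Set Ω} (hS : MeasurableSet S) (b : ℕ) :
    |(q.withDensity fun y => ENNReal.ofReal (w y)).real S -
        (Kernel.trajMeasure (X := fun _ : ℕ => Ω × Ω) ν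
          (fun n : ℕ => Khat.comap (fun h : (i : ↥(Finset.Iic n)) → Ω × Ω => h ⟨n, Finset.mem_Iic.2 le_rfl⟩)
            (measurable_pi_apply _))).real {z | (z b).2 ∈ S}| ≤
      (∫⁻ p in {p : Ω × Ω | w p.2 ≤ w p.1} ∩ (Set.diagonal Ω)ᶜ, (1 - imhAcceptMass q w p.1) ^ b * (imhAcceptMass q w p.1)⁻¹ ∂ν +
        ∫⁻ p in {p : Ω × Ω | w p.2 ≤ w p.1}ᶜ ∩ (Set.diagonal Ω)ᶜ, (1 - imhAcceptMass q w p.2) ^ b * (imhAcceptMass q w p.2)⁻¹ ∂ν).toReal := by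
  have hw : Measurable w := Fact.out
  have h := crnLag_measureReal_sub_abs_le_tsum_offDiagonal hw0 hmax Khat hK ν hlag hS b
  have hconv : ∑' n, ((fun m : Measure (Ω × Ω) => m.bind Khat)^[b + n] ν).real (Set.diagonal Ω)ᶜ =
      (∑' n, ((fun m : Measure (Ω × Ω) => m.bind Khat)^[b + n] ν) (Set.diagonal Ω)ᶜ).toReal := by
    simp only [measureReal_def]
    exact (ENNReal.tsum_toReal_eq fun n => by
      haveI := isProbabilityMeasure_iterate_bind (κ := Khat) ν (b + n)
      exact measure_ne_top _ _).symm
  rw [hconv, tsum_iterate_bind_crnPair_offDiagonal_shift_eq_anyCoupling hw hw0 hq Khat hK ν b] at h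
  exact h

/-! ## §3 Deterministic starts: an explicit integral against the proposal -/

/-- **Off the current configuration, one update is the accepted-proposal measure**: `∫_{y ≠ x} g dK(x, ·) = ∫ a(x, y)·g(y) q(dy)` when the
proposal has no atom at `x` (`w` a `Fact`-measurable weight). [ours] -/
theorem setLIntegral_compl_singleton_indepMH [MeasurableSingletonClass Ω] [Fact (Measurable w)] (x : Ω) (hqx : q {x} = 0)
    {g : Ω → ℝ≥0∞} (hg : Measurable g) :
    ∫⁻ y in ({x}ᶜ : Set Ω), g y ∂(indepMH q w x) = ∫⁻ y, imhAcceptE w x y * g y ∂q := by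
  have hw : Measurable w := Fact.out
  have hxc : MeasurableSet ({x}ᶜ : Set Ω) := (measurableSet_singleton x).compl
  have hgi : Measurable (({x}ᶜ : Set Ω).indicator g) := hg.indicator hxc
  have h2 : Measurable (Function.uncurry fun (x : Ω) (_ : Ω) => 1 - imhAcceptMass q w x) :=
    measurable_const.sub ((measurable_imhAcceptMass q hw).comp measurable_fst)
  have hx0 : ({x}ᶜ : Set Ω).indicator g x = 0 :=
    Set.indicator_of_notMem (fun h => Set.notMem_of_mem_compl h (Set.mem_singleton x)) _
  rw [← lintegral_indicator hxc, indepMH, Kernel.add_apply, lintegral_add_measure,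
    Kernel.withDensity_apply _ (measurable_imhAcceptE hw), Kernel.const_apply,
    lintegral_withDensity_eq_lintegral_mul _ (measurable_imhAcceptE hw).of_uncurry_left hgi,
    Kernel.withDensity_apply _ h2, Kernel.deterministic_apply, withDensity_const,
    lintegral_smul_measure, lintegral_dirac' _ hgi, smul_eq_mul]
  -- the rejection part does not charge `{x}ᶜ`; the proposal part misses the indicator only on the null set `{x}`
  simp only [id_eq, hx0, mul_zero, add_zero]
  refine lintegral_congr_ae ?_
  filter_upwards [(measure_eq_zero_iff_ae_notMem.1 hqx : ∀ᵐ y ∂q, y ∉ ({x} : Set Ω))] with y hy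
  show imhAcceptE w x y * ({x}ᶜ : Set Ω).indicator g y = imhAcceptE w x y * g y
  rw [Set.indicator_of_mem (show y ∈ ({x}ᶜ : Set Ω) from hy)]

/-- **THE SPLIT INTEGRAL FOR `ν̂_x = K(x, ·) ⊗ δ_x`** (no atom at `x`; `w` a `Fact`-measurable weight): for measurable `g`,
`∫_{O∩Δᶜ} g(p.1) dν̂_x + ∫_{Oᶜ∩Δᶜ} g(p.2) dν̂_x = ∫ a(x, y)·g(x ∨ y) q(dy)` with `x ∨ y = y` if `w(x) ≤ w(y)`, else `x`. [ours] -/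
theorem lintegral_detLag_split [MeasurableSingletonClass Ω] [MeasurableEq Ω] [Fact (Measurable w)] (x : Ω) (hqx : q {x} = 0)
    {g : Ω → ℝ≥0∞} (hg : Measurable g) :
    ∫⁻ p in {p : Ω × Ω | w p.2 ≤ w p.1} ∩ (Set.diagonal Ω)ᶜ, g p.1 ∂((indepMH q w x).prod (Measure.dirac x)) +
        ∫⁻ p in {p : Ω × Ω | w p.2 ≤ w p.1}ᶜ ∩ (Set.diagonal Ω)ᶜ, g p.2 ∂((indepMH q w x).prod (Measure.dirac x)) =
      ∫⁻ y, imhAcceptE w x y * g (if w x ≤ w y then y else x) ∂q := by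
  have hw : Measurable w := Fact.out
  have hO : MeasurableSet {p : Ω × Ω | w p.2 ≤ w p.1} := measurableSet_le (hw.comp measurable_snd) (hw.comp measurable_fst)
  have hD : MeasurableSet (Set.diagonal Ω) := measurableSet_diagonal
  have hB : MeasurableSet {y : Ω | w x ≤ w y} := measurableSet_le measurable_const hw
  have hxc : MeasurableSet ({x}ᶜ : Set Ω) := (measurableSet_singleton x).compl
  set G : Ω → ℝ≥0∞ := fun y => g (if w x ≤ w y then y else x) with hG
  have hGm : Measurable G := hg.comp (Measurable.ite hB measurable_id measurable_const)
  have hpre1 : (fun y : Ω => (y, x)) ⁻¹' ({p : Ω × Ω | w p.2 ≤ w p.1} ∩ (Set.diagonal Ω)ᶜ) = ({x}ᶜ : Set Ω) ∩ {y | w x ≤ w y} := by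
    ext y
    simp only [Set.mem_preimage, Set.mem_inter_iff, Set.mem_setOf_eq, Set.mem_compl_iff, Set.mem_diagonal_iff, Set.mem_singleton_iff]
    tauto
  have hpre2 : (fun y : Ω => (y, x)) ⁻¹' ({p : Ω × Ω | w p.2 ≤ w p.1}ᶜ ∩ (Set.diagonal Ω)ᶜ) = ({x}ᶜ : Set Ω) \ {y | w x ≤ w y} := by
    ext y
    simp only [Set.mem_preimage, Set.mem_inter_iff, Set.mem_setOf_eq, Set.mem_compl_iff, Set.mem_diagonal_iff, Set.mem_singleton_iff,
      Set.mem_sdiff]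
    tauto
  rw [Measure.prod_dirac, setLIntegral_map (f := fun p : Ω × Ω => g p.1) (hO.inter hD.compl) (hg.comp measurable_fst) measurable_prodMk_right,
    setLIntegral_map (f := fun p : Ω × Ω => g p.2) (hO.compl.inter hD.compl) (hg.comp measurable_snd) measurable_prodMk_right, hpre1, hpre2]
  have hE1 : ∫⁻ y in ({x}ᶜ : Set Ω) ∩ {y | w x ≤ w y}, g ((y, x).1) ∂(indepMH q w x) = ∫⁻ y in ({x}ᶜ : Set Ω) ∩ {y | w x ≤ w y}, G y ∂(indepMH q w x) :=
    setLIntegral_congr_fun (hxc.inter hB) fun y hy => by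
      show g y = g (if w x ≤ w y then y else x)
      rw [if_pos (show w x ≤ w y from hy.2)]
  have hE2 : ∫⁻ y in ({x}ᶜ : Set Ω) \ {y | w x ≤ w y}, g ((y, x).2) ∂(indepMH q w x) = ∫⁻ y in ({x}ᶜ : Set Ω) \ {y | w x ≤ w y}, G y ∂(indepMH q w x) :=
    setLIntegral_congr_fun (hxc.diff hB) fun y hy => by
      show g x = g (if w x ≤ w y then y else x)
      rw [if_neg (show ¬ (w x ≤ w y) from hy.2)]
  rw [hE1, hE2, lintegral_inter_add_sdiff G ({x}ᶜ : Set Ω) hB, setLIntegral_compl_singleton_indepMH x hqx hGm]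

/-- **A START-ADAPTIVE CONVERGENCE BOUND FOR THE EXACT SAMPLER.**  `w` a `Fact`-measurable normalised weight, positive, maximal at `x₀`;
standard Borel `Ω`; atom-free proposal.  For EVERY starting configuration `x`, every measurable `S` and every `b`:
`|π(S) − δ_x K^b(S)| ≤ ∫ a(x, y)·(1 − A(x ∨ y))^b·A(x ∨ y)⁻¹ q(dy)` — the coupling diagnostic of the run started at `x`, in closed form
(`x ∨ y = y` if `w(x) ≤ w(y)`, else `x`). [ours] -/
theorem imh_detStart_measureReal_sub_abs_le [StandardBorelSpace Ω] [Nonempty Ω] [MeasurableSingletonClass Ω] [MeasurableEq Ω]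
    [Fact (Measurable w)] (hw0 : ∀ y, 0 < w y) {x₀ : Ω} (hmax : ∀ y, w y ≤ w x₀)
    [IsProbabilityMeasure (q.withDensity fun y => ENNReal.ofReal (w y))] (hq : ∀ x, q {x} = 0) (x : Ω) {S : Set Ω} (hS : MeasurableSet S)
    (b : ℕ) :
    |(q.withDensity fun y => ENNReal.ofReal (w y)).real S - ((fun m : Measure Ω => m.bind (indepMH q w))^[b] (Measure.dirac x)).real S| ≤
      (∫⁻ y, imhAcceptE w x y * ((1 - imhAcceptMass q w (if w x ≤ w y then y else x)) ^ b *
        (imhAcceptMass q w (if w x ≤ w y then y else x))⁻¹) ∂q).toReal := by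
  have hw : Measurable w := Fact.out
  have hAm : Measurable fun x : Ω => imhAcceptMass q w x := measurable_imhAcceptMass q hw
  obtain ⟨Khat, hMk, hK⟩ := exists_crnPairKernel (q := q) hw
  haveI := hMk
  have h := crnLag_measureReal_sub_abs_le_lintegral_anyCoupling hw0 hmax hq Khat hK ((indepMH q w x).prod (Measure.dirac x))
    (coldLag_lagOne x) hS b
  rw [crn_coldSnd_measureReal_snd_eq hw0 Khat hK _ (coldLag_map_fst_snd (q := q) (w := w) x).2 hS b,
    lintegral_detLag_split x (hq x) (g := fun z => (1 - imhAcceptMass q w z) ^ b * (imhAcceptMass q w z)⁻¹)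
      (((measurable_const.sub hAm).pow_const b).mul hAm.inv)] at h
  exact h

end Summit.Ventures.LatticeQCDFlow.Exactness

end
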